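import Summits.BirchSwinnertonDyer.BirchSwinnertonDyer.Theorems.ResidualThetaTransportAtTwoSignedMuVanishingAtTwoPlusMultOneCuspSpanAnchor
import Summits.BirchSwinnertonDyer.BirchSwinnertonDyer.Theorems.ResidualThetaTransportAtTwoThetaLayerLambdaCongruenceAtTwoCuspSpanDescentTable35
import Summits.BirchSwinnertonDyer.BirchSwinnertonDyer.Theorems.ResidualThetaTransportAtTwoThetaLayerLambdaCongruenceAtTwoCuspSpanDescentTable51b
import Summits.BirchSwinnertonDyer.BirchSwinnertonDyer.Theorems.ResidualThetaTransportAtTwoSignedMuVanishingAtTwoPlusMultOneOldFamilyTwoPrimes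
import Summits.BirchSwinnertonDyer.BirchSwinnertonDyer.Theorems.ResidualThetaTransportAtTwoSignedMuVanishingAtTwoPlusMultOneOldFamilyPrimePow
import Summits.BirchSwinnertonDyer.BirchSwinnertonDyer.Theorems.ResidualThetaTransportAtTwoSignedMuVanishingAtTwoPlusMultOneOldFamilyPrimeSq
import Summits.BirchSwinnertonDyer.BirchSwinnertonDyer.Theorems.ByReductionTypeAtTwoSupersingularUnitAnchorClass81305a
import Summits.BirchSwinnertonDyer.BirchSwinnertonDyer.Theorems.ByReductionTypeAtTwoSupersingularUnitAnchorClass499555e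
import Summits.BirchSwinnertonDyer.BirchSwinnertonDyer.Theorems.ByReductionTypeAtTwoSupersingularUnitAnchorClass347361g
import HarnessLib
-- buildfix (bf3-g30) G30-17: comment-only touch to re-dispatch the lane build (dead-lettered rc 76 ×7 behind Theorems.ByReductionTypeAtTwoSupersingularThetaHabitat, which bf3-g29 re-glued p635943 (hub olean 13:14); no build event since 12:21; operator express ask 14:2x unserved); declarations byte-identical

/-!
# Route `ResidualThetaTransportAtTwo`, crux Kμ⁺ `SignedMuVanishingAtTwoPlus` (stmt-BirchSwinnertonDyer-20689), line
# `birth`, stub `stub_flatMuZeroAtTwo`: CLASS INSTANCES WITHOUT ANY `L`-VALUE INPUT at COMPOSITE anchor levels — FLAT at `2` at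
# the habitat⁺ classes **81305a1**, **499555e1** (anchor `35a1`) and **347361g1** (anchor `51a1`), the analytic residue being the
# kernel certificates `CuspSpanEvenAtTwo 35`, `CuspSpanEvenAtTwo 51`

Cell `bsd-wall`, width seat `bsd-wall-rtt-p4-w2` (g5). THEOREMS ONLY; helper `--supports` the crux; INSTANCES, not a booking;
closes nothing. BSD is not proved by this; the four print facts of the (MO⁺) dictionary stay hypotheses.

The predecessor instances `flatAtTwo_81305a1` (p621143; `N = 35·23·101`, two level-raising primes), `flatAtTwo_499555e1` (p622183;
`N = 35·7·2039`, pattern `ℓ·q`, `ℓ = 7 ∣ 35`) and `flatAtTwo_347361g1` (p620672; `N = 51·139·7²`, pattern `q·ℓ²`) reduce FLAT at these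
classes to the four named facts + Cremona's conductor / parity data + kernel certificates + ONE `L`-value `[0]⁺_anchor = 1/3` (`hL`).
The anchor levels `35 = 5·7` and `51 = 3·17` are COMPOSITE (outside the (U4) generation theorems), but the node there is now a KERNEL
theorem — `cuspSpanEvenAtTwo_level35`, `cuspSpanEvenAtTwo_level51` (width seat rtt-p3-w2 g3's descent-table certificates,
`…CuspSpanDescentTable35` / `…DescentTable51b`) — so by the ANCHOR PRINCIPLE `exists_odd_ratPlusSymbol_of_cuspSpanEvenAtTwo`
(`…MultOneCuspSpanAnchor`, this seat) the hypothesis `hL` is DROPPED. With `…MultOneCuspSpanAnchorClasses` (157113h1, 282093g1)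
this makes 5 of the 6 certified habitat⁺ classes L-value-free; the remaining anchor is 267 (class 138039d1).

References: [CremonaAlgorithms1997] Table 1; [Buzzard2000LevelLoweringModTwo] Prop. 2.4; [SerreInventiones1972] Prop. 12;
[DarmonDiamondTaylor1995] Lemma 1.38; [Mazur1978]; [EmertonPollackWeston2006] §4.4; [DiamondShurman2005] §5.7; [Pollack2003]
Conj. 6.3, Prop. 6.18.
-/

set_option autoImplicit false
set_option linter.dupNamespace false

noncomputable section

open scoped Classical MatrixGroups ModularForm

open CongruenceSubgroup Field WeierstrassCurve Literature.NumberTheory.EllipticCurves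
  Literature.NumberTheory.EllipticCurves.ModularForms Literature.NumberTheory.EllipticCurves.Rank1Residual
  Literature.NumberTheory.IwasawaTheory Summit.BirchSwinnertonDyer.Rank1Residual.Supersingular
  Summit.BirchSwinnertonDyer.BirchSwinnertonDyer.Theses.ResidualThetaTransportAtTwo

namespace Summit.BirchSwinnertonDyer.BirchSwinnertonDyer.Theorems.SignedMuAtTwo

namespace MultOneDictionary

/-- **FLAT at `2` AT `81305a1` (anchor `35a1`, `N = 35·23·101`) with NO `L`-value input**: from the four named facts, Cremona's
conductor / parity data, the kernel certificates, and the kernel theorem `CuspSpanEvenAtTwo 35`. [cite: CremonaAlgorithms1997, Table 1]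
[cite: Buzzard2000LevelLoweringModTwo, Prop. 2.4] [cite: DarmonDiamondTaylor1995, §1.6 Lemma 1.38] [cite: SerreInventiones1972, §1.11 Prop. 12]
[cite: Mazur1978, Thm. 1] [cite: EmertonPollackWeston2006, §4.4] [cite: Pollack2003, Conj. 6.3 and Prop. 6.18] -/
theorem flatAtTwo_81305a1_of_cuspSpan (hBuz : buzzard2000_multiplicityOne_gamma0)
    (hSe : serre1972_supersingular_decompositionSubgroup_image) (hSD : heckeSelfDual_torsionBy_J0)
    (hMK : mazurKenku_exists_cyclic_isogeny)
    [((⟨0, 0, 1, -673395028, -6740510352317⟩ : WeierstrassCurve ℤ).baseChange ℚ).IsElliptic] [((⟨0, 0, 1, -673395028, -6740510352317⟩ : WeierstrassCurve ℤ).baseChange ℚ).IsGloballyMinimal]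
    [((⟨0, 1, 1, 9, 1⟩ : WeierstrassCurve ℤ).baseChange ℚ).IsElliptic] [((⟨0, 1, 1, 9, 1⟩ : WeierstrassCurve ℤ).baseChange ℚ).IsGloballyMinimal]
    -- displayed certificates (Cremona Table 1)
    (hNW : ((⟨0, 0, 1, -673395028, -6740510352317⟩ : WeierstrassCurve ℤ).baseChange ℚ).conductorNorm ℤ = 81305)
    (hNA : ((⟨0, 1, 1, 9, 1⟩ : WeierstrassCurve ℤ).baseChange ℚ).conductorNorm ℤ = 35)
    (hW5 : Odd (((⟨0, 0, 1, -673395028, -6740510352317⟩ : WeierstrassCurve ℤ).baseChange ℚ).LFunction 5)) (hW7 : Odd (((⟨0, 0, 1, -673395028, -6740510352317⟩ : WeierstrassCurve ℤ).baseChange ℚ).LFunction 7))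
    (hW23 : Odd (((⟨0, 0, 1, -673395028, -6740510352317⟩ : WeierstrassCurve ℤ).baseChange ℚ).LFunction 23)) (hW101 : Odd (((⟨0, 0, 1, -673395028, -6740510352317⟩ : WeierstrassCurve ℤ).baseChange ℚ).LFunction 101))
    (hA5 : Odd (((⟨0, 1, 1, 9, 1⟩ : WeierstrassCurve ℤ).baseChange ℚ).LFunction 5)) (hA7 : Odd (((⟨0, 1, 1, 9, 1⟩ : WeierstrassCurve ℤ).baseChange ℚ).LFunction 7))
    (hA23 : Even (((⟨0, 1, 1, 9, 1⟩ : WeierstrassCurve ℤ).baseChange ℚ).LFunction 23)) (hA101 : Even (((⟨0, 1, 1, 9, 1⟩ : WeierstrassCurve ℤ).baseChange ℚ).LFunction 101))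
    [NeZero (((⟨0, 0, 1, -673395028, -6740510352317⟩ : WeierstrassCurve ℤ).baseChange ℚ).conductorNorm ℤ)]
    (f : CuspForm (Gamma0 (((⟨0, 0, 1, -673395028, -6740510352317⟩ : WeierstrassCurve ℤ).baseChange ℚ).conductorNorm ℤ)) 2) (hf : IsNewformOf ((⟨0, 0, 1, -673395028, -6740510352317⟩ : WeierstrassCurve ℤ).baseChange ℚ) f)
    (g : CuspForm (Gamma0 35) 2) (hg : IsNewformOf ((⟨0, 1, 1, 9, 1⟩ : WeierstrassCurve ℤ).baseChange ℚ) g) :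
    ∀ Lplus Lminus : IwasawaAlgebra 2, IsPollackPair f 2 Lplus Lminus → ¬ PowerSeries.C (2 : ℤ_[2]) ∣ Lminus := by
  have hE := SSColemanRoad.goodSS_two_81305a1
  have hA := SSUnitAnchor.goodSS_two_ua35a1
  have hΔ : ((⟨0, 0, 1, -673395028, -6740510352317⟩ : WeierstrassCurve ℤ).baseChange ℚ).Δ < 0 := by
    rw [baseChange_int_Δ, SSColemanRoad.M81305a1_Δ]; norm_num
  obtain ⟨e, he⟩ := SSUnitAnchor.twoTorsion_congruent_81305a1_ua35a1
  -- eigenvalue functions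
  have hAf : ∀ p : ℕ, p.Prime → cuspCoeff f p = (((((⟨0, 0, 1, -673395028, -6740510352317⟩ : WeierstrassCurve ℤ).baseChange ℚ).LFunction p : ℤ)) : ℂ) := fun p _ ↦ hf.2 p
  have hBg : ∀ p : ℕ, p.Prime → cuspCoeff g p = (((((⟨0, 1, 1, 9, 1⟩ : WeierstrassCurve ℤ).baseChange ℚ).LFunction p : ℤ)) : ℂ) := fun p _ ↦ hg.2 p
  have hA2 : ((⟨0, 1, 1, 9, 1⟩ : WeierstrassCurve ℤ).baseChange ℚ).LFunction 2 = 0 := by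
    rw [LFunction_apply_prime_eq_frobeniusTrace _ 2 hA.1, hA.2.1]
  -- the residue from the kernel THEOREM `CuspSpanEvenAtTwo 35` (`cuspSpanEvenAtTwo_level35`, rtt-p3-w2 g3's descent table): no `L`-value input
  have hres : ∃ k : ℕ, 1 ≤ k ∧ ∃ b : ℤ, Odd b ∧ ∃ m : ℤ, Odd m ∧
      ratPlusSymbol g ((b : ℚ) / 4 ^ k) = ratPlusSymbol g 0 + (m : ℚ) / 2 :=
    exists_odd_ratPlusSymbol_of_cuspSpanEvenAtTwo g hg.1 hg.coeffField_eq_bot (by decide) (a := 0) (by simp [hg.2 2, hA2])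
      Even.zero cuspSpanEvenAtTwo_level35
  have hN : 35 * (23 * 101) = ((⟨0, 0, 1, -673395028, -6740510352317⟩ : WeierstrassCurve ℤ).baseChange ℚ).conductorNorm ℤ := by
    norm_num [hNW]
  have hNA' : ((⟨0, 1, 1, 9, 1⟩ : WeierstrassCurve ℤ).baseChange ℚ).conductorNorm ℤ ∣ ((⟨0, 0, 1, -673395028, -6740510352317⟩ : WeierstrassCurve ℤ).baseChange ℚ).conductorNorm ℤ := by
    rw [hNA, hNW]; norm_num
  -- two odd integers agree mod 2
  have hodd : ∀ a b : ℤ, Odd a → Odd b → ((a : ℤ) : ZMod 2) = ((b : ℤ) : ZMod 2) := by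
    rintro a b ⟨c, rfl⟩ ⟨d, rfl⟩
    push_cast
    have h2 : (2 : ZMod 2) = 0 := by decide
    rw [h2, zero_mul, zero_mul]
  refine flatAtTwo_turnkey_two_primes_level hBuz hSe hSD hMK hE.2.2 hE.2.1 hΔ hf _ hAf _ hNA' e he
    (N₀ := 35) (q₁ := 23) (q₂ := 101) (by norm_num) (by norm_num) (by norm_num) (by decide) (by decide) hN g hg _ hBg
    (by rw [hA2]; exact Even.zero) hA23 hA101 hW23 hW101 (fun p hp hp35 ↦ ?_) hres
  -- `p ∣ 35 ⇒ p ∈ {5, 7}`, where both curves are multiplicative (`a_p` odd)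
  rcases (Nat.Prime.dvd_mul hp : p ∣ 5 * 7 ↔ _).mp hp35 with h | h
  · obtain rfl := (Nat.prime_dvd_prime_iff_eq hp (by norm_num)).mp h
    exact hodd _ _ hW5 hA5
  · obtain rfl := (Nat.prime_dvd_prime_iff_eq hp (by norm_num)).mp h
    exact hodd _ _ hW7 hA7

/-- **FLAT at `2` AT `499555e1` (anchor `35a1`, `N = 35·7·2039`) with NO `L`-value input**: from the four named facts,
Cremona's conductor / parity data, the kernel certificates, and the kernel theorem `CuspSpanEvenAtTwo 35`.
[cite: CremonaAlgorithms1997, Table 1] [cite: Buzzard2000LevelLoweringModTwo, Prop. 2.4] [cite: DarmonDiamondTaylor1995, §1.6 Lemma 1.38]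
[cite: SerreInventiones1972, §1.11 Prop. 12] [cite: Mazur1978, Thm. 1] [cite: EmertonPollackWeston2006, §4.4]
[cite: Pollack2003, Conj. 6.3 and Prop. 6.18] -/
theorem flatAtTwo_499555e1_of_cuspSpan (hBuz : buzzard2000_multiplicityOne_gamma0)
    (hSe : serre1972_supersingular_decompositionSubgroup_image) (hSD : heckeSelfDual_torsionBy_J0)
    (hMK : mazurKenku_exists_cyclic_isogeny)
    [((⟨0, 0, 1, -164668, -68491061⟩ : WeierstrassCurve ℤ).baseChange ℚ).IsElliptic] [((⟨0, 0, 1, -164668, -68491061⟩ : WeierstrassCurve ℤ).baseChange ℚ).IsGloballyMinimal]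
    [((⟨0, 1, 1, 9, 1⟩ : WeierstrassCurve ℤ).baseChange ℚ).IsElliptic] [((⟨0, 1, 1, 9, 1⟩ : WeierstrassCurve ℤ).baseChange ℚ).IsGloballyMinimal]
    -- displayed certificates (Cremona Table 1)
    (hNW : ((⟨0, 0, 1, -164668, -68491061⟩ : WeierstrassCurve ℤ).baseChange ℚ).conductorNorm ℤ = 499555)
    (hNA : ((⟨0, 1, 1, 9, 1⟩ : WeierstrassCurve ℤ).baseChange ℚ).conductorNorm ℤ = 35)
    (hW5 : Odd (((⟨0, 0, 1, -164668, -68491061⟩ : WeierstrassCurve ℤ).baseChange ℚ).LFunction 5)) (hW2039 : Odd (((⟨0, 0, 1, -164668, -68491061⟩ : WeierstrassCurve ℤ).baseChange ℚ).LFunction 2039))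
    (hW7 : Even (((⟨0, 0, 1, -164668, -68491061⟩ : WeierstrassCurve ℤ).baseChange ℚ).LFunction 7))
    (hA5 : Odd (((⟨0, 1, 1, 9, 1⟩ : WeierstrassCurve ℤ).baseChange ℚ).LFunction 5)) (hA7 : Odd (((⟨0, 1, 1, 9, 1⟩ : WeierstrassCurve ℤ).baseChange ℚ).LFunction 7))
    (hA2039 : Even (((⟨0, 1, 1, 9, 1⟩ : WeierstrassCurve ℤ).baseChange ℚ).LFunction 2039))
    [NeZero (((⟨0, 0, 1, -164668, -68491061⟩ : WeierstrassCurve ℤ).baseChange ℚ).conductorNorm ℤ)]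
    (f : CuspForm (Gamma0 (((⟨0, 0, 1, -164668, -68491061⟩ : WeierstrassCurve ℤ).baseChange ℚ).conductorNorm ℤ)) 2) (hf : IsNewformOf ((⟨0, 0, 1, -164668, -68491061⟩ : WeierstrassCurve ℤ).baseChange ℚ) f)
    (g : CuspForm (Gamma0 35) 2) (hg : IsNewformOf ((⟨0, 1, 1, 9, 1⟩ : WeierstrassCurve ℤ).baseChange ℚ) g) :
    ∀ Lplus Lminus : IwasawaAlgebra 2, IsPollackPair f 2 Lplus Lminus → ¬ PowerSeries.C (2 : ℤ_[2]) ∣ Lminus := by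
  have hE := SSColemanRoad.goodSS_two_499555e1
  have hA := SSUnitAnchor.goodSS_two_ua35a1
  have hΔ : ((⟨0, 0, 1, -164668, -68491061⟩ : WeierstrassCurve ℤ).baseChange ℚ).Δ < 0 := by
    rw [baseChange_int_Δ, SSColemanRoad.M499555e1_Δ]; norm_num
  obtain ⟨e, he⟩ := SSUnitAnchor.twoTorsion_congruent_499555e1_ua35a1
  have hAf : ∀ p : ℕ, p.Prime → cuspCoeff f p = (((((⟨0, 0, 1, -164668, -68491061⟩ : WeierstrassCurve ℤ).baseChange ℚ).LFunction p : ℤ)) : ℂ) := fun p _ ↦ hf.2 p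
  have hBg : ∀ p : ℕ, p.Prime → cuspCoeff g p = (((((⟨0, 1, 1, 9, 1⟩ : WeierstrassCurve ℤ).baseChange ℚ).LFunction p : ℤ)) : ℂ) := fun p _ ↦ hg.2 p
  have hA2 : ((⟨0, 1, 1, 9, 1⟩ : WeierstrassCurve ℤ).baseChange ℚ).LFunction 2 = 0 := by
    rw [LFunction_apply_prime_eq_frobeniusTrace _ 2 hA.1, hA.2.1]
  -- the residue from the kernel THEOREM `CuspSpanEvenAtTwo 35` (`cuspSpanEvenAtTwo_level35`, rtt-p3-w2 g3's descent table): no `L`-value input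
  have hres : ∃ k : ℕ, 1 ≤ k ∧ ∃ b : ℤ, Odd b ∧ ∃ m : ℤ, Odd m ∧
      ratPlusSymbol g ((b : ℚ) / 4 ^ k) = ratPlusSymbol g 0 + (m : ℚ) / 2 :=
    exists_odd_ratPlusSymbol_of_cuspSpanEvenAtTwo g hg.1 hg.coeffField_eq_bot (by decide) (a := 0) (by simp [hg.2 2, hA2])
      Even.zero cuspSpanEvenAtTwo_level35
  have hN : 35 * (7 * 2039) = ((⟨0, 0, 1, -164668, -68491061⟩ : WeierstrassCurve ℤ).baseChange ℚ).conductorNorm ℤ := by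
    norm_num [hNW]
  have hNA' : ((⟨0, 1, 1, 9, 1⟩ : WeierstrassCurve ℤ).baseChange ℚ).conductorNorm ℤ ∣ ((⟨0, 0, 1, -164668, -68491061⟩ : WeierstrassCurve ℤ).baseChange ℚ).conductorNorm ℤ := by
    rw [hNA, hNW]; norm_num
  -- two odd integers agree mod 2
  have hodd : ∀ a b : ℤ, Odd a → Odd b → ((a : ℤ) : ZMod 2) = ((b : ℤ) : ZMod 2) := by
    rintro a b ⟨c, rfl⟩ ⟨d, rfl⟩
    push_cast
    have h2 : (2 : ZMod 2) = 0 := by decide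
    rw [h2, zero_mul, zero_mul]
  refine flatAtTwo_turnkey_primePow_level hBuz hSe hSD hMK hE.2.2 hE.2.1 hΔ hf _ hAf _ hNA' e he
    (N₀ := 35) (q := 2039) (ℓ := 7) (by norm_num) (by norm_num) (by norm_num) (by decide) (by decide) hN g hg _ hBg
    (by rw [hA2]; exact Even.zero) hA2039 hW2039 hA7 hW7 (fun p hp hp35 hp7 ↦ ?_) hres
  -- `p ∣ 35`, `p ≠ 7` ⇒ `p = 5`, where both curves are multiplicative (`a₅` odd)
  rcases (Nat.Prime.dvd_mul hp : p ∣ 5 * 7 ↔ _).mp hp35 with h | h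
  · obtain rfl := (Nat.prime_dvd_prime_iff_eq hp (by norm_num)).mp h
    exact hodd _ _ hW5 hA5
  · exact absurd ((Nat.prime_dvd_prime_iff_eq hp (by norm_num)).mp h) hp7

/-- **FLAT at `2` AT `347361g1` (anchor `51a1`, `N = 51·139·7²`) with NO `L`-value input**: from the four named facts,
Cremona's conductor / parity data, the kernel certificates, and the kernel theorem `CuspSpanEvenAtTwo 51`.
[cite: CremonaAlgorithms1997, Table 1] [cite: Buzzard2000LevelLoweringModTwo, Prop. 2.4] [cite: DarmonDiamondTaylor1995, §1.6 Lemma 1.38]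
[cite: SerreInventiones1972, §1.11 Prop. 12] [cite: Mazur1978, Thm. 1] [cite: EmertonPollackWeston2006, §4.4]
[cite: Pollack2003, Conj. 6.3 and Prop. 6.18] -/
theorem flatAtTwo_347361g1_of_cuspSpan (hBuz : buzzard2000_multiplicityOne_gamma0)
    (hSe : serre1972_supersingular_decompositionSubgroup_image) (hSD : heckeSelfDual_torsionBy_J0)
    (hMK : mazurKenku_exists_cyclic_isogeny)
    [((⟨0, -1, 1, -32210705, -70352938111⟩ : WeierstrassCurve ℤ).baseChange ℚ).IsElliptic] [((⟨0, -1, 1, -32210705, -70352938111⟩ : WeierstrassCurve ℤ).baseChange ℚ).IsGloballyMinimal]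
    [((⟨0, 1, 1, 1, -1⟩ : WeierstrassCurve ℤ).baseChange ℚ).IsElliptic] [((⟨0, 1, 1, 1, -1⟩ : WeierstrassCurve ℤ).baseChange ℚ).IsGloballyMinimal]
    -- displayed certificates (Cremona Table 1)
    (hNW : ((⟨0, -1, 1, -32210705, -70352938111⟩ : WeierstrassCurve ℤ).baseChange ℚ).conductorNorm ℤ = 347361)
    (hNA : ((⟨0, 1, 1, 1, -1⟩ : WeierstrassCurve ℤ).baseChange ℚ).conductorNorm ℤ = 51)
    (hW3 : Odd (((⟨0, -1, 1, -32210705, -70352938111⟩ : WeierstrassCurve ℤ).baseChange ℚ).LFunction 3)) (hW17 : Odd (((⟨0, -1, 1, -32210705, -70352938111⟩ : WeierstrassCurve ℤ).baseChange ℚ).LFunction 17))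
    (hW139 : Odd (((⟨0, -1, 1, -32210705, -70352938111⟩ : WeierstrassCurve ℤ).baseChange ℚ).LFunction 139)) (hW7 : Even (((⟨0, -1, 1, -32210705, -70352938111⟩ : WeierstrassCurve ℤ).baseChange ℚ).LFunction 7))
    (hA3 : Odd (((⟨0, 1, 1, 1, -1⟩ : WeierstrassCurve ℤ).baseChange ℚ).LFunction 3)) (hA17 : Odd (((⟨0, 1, 1, 1, -1⟩ : WeierstrassCurve ℤ).baseChange ℚ).LFunction 17))
    (hA139 : Even (((⟨0, 1, 1, 1, -1⟩ : WeierstrassCurve ℤ).baseChange ℚ).LFunction 139)) (hA7 : Even (((⟨0, 1, 1, 1, -1⟩ : WeierstrassCurve ℤ).baseChange ℚ).LFunction 7))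
    [NeZero (((⟨0, -1, 1, -32210705, -70352938111⟩ : WeierstrassCurve ℤ).baseChange ℚ).conductorNorm ℤ)]
    (f : CuspForm (Gamma0 (((⟨0, -1, 1, -32210705, -70352938111⟩ : WeierstrassCurve ℤ).baseChange ℚ).conductorNorm ℤ)) 2) (hf : IsNewformOf ((⟨0, -1, 1, -32210705, -70352938111⟩ : WeierstrassCurve ℤ).baseChange ℚ) f)
    (g : CuspForm (Gamma0 51) 2) (hg : IsNewformOf ((⟨0, 1, 1, 1, -1⟩ : WeierstrassCurve ℤ).baseChange ℚ) g) :
    ∀ Lplus Lminus : IwasawaAlgebra 2, IsPollackPair f 2 Lplus Lminus → ¬ PowerSeries.C (2 : ℤ_[2]) ∣ Lminus := by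
  have hE := SSColemanRoad.goodSS_two_347361g1
  have hA := SSUnitAnchor.goodSS_two_ua51a1
  have hΔ : ((⟨0, -1, 1, -32210705, -70352938111⟩ : WeierstrassCurve ℤ).baseChange ℚ).Δ < 0 := by
    rw [baseChange_int_Δ, SSColemanRoad.M347361g1_Δ]; norm_num
  obtain ⟨e, he⟩ := SSUnitAnchor.twoTorsion_congruent_347361g1_ua51a1
  have hAf : ∀ p : ℕ, p.Prime → cuspCoeff f p = (((((⟨0, -1, 1, -32210705, -70352938111⟩ : WeierstrassCurve ℤ).baseChange ℚ).LFunction p : ℤ)) : ℂ) := fun p _ ↦ hf.2 p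
  have hBg : ∀ p : ℕ, p.Prime → cuspCoeff g p = (((((⟨0, 1, 1, 1, -1⟩ : WeierstrassCurve ℤ).baseChange ℚ).LFunction p : ℤ)) : ℂ) := fun p _ ↦ hg.2 p
  have hA2 : ((⟨0, 1, 1, 1, -1⟩ : WeierstrassCurve ℤ).baseChange ℚ).LFunction 2 = 0 := by
    rw [LFunction_apply_prime_eq_frobeniusTrace _ 2 hA.1, hA.2.1]
  -- the residue from the kernel THEOREM `CuspSpanEvenAtTwo 51` (`cuspSpanEvenAtTwo_level51`, rtt-p3-w2 g3's descent table): no `L`-value input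
  have hres : ∃ k : ℕ, 1 ≤ k ∧ ∃ b : ℤ, Odd b ∧ ∃ m : ℤ, Odd m ∧
      ratPlusSymbol g ((b : ℚ) / 4 ^ k) = ratPlusSymbol g 0 + (m : ℚ) / 2 :=
    exists_odd_ratPlusSymbol_of_cuspSpanEvenAtTwo g hg.1 hg.coeffField_eq_bot (by decide) (a := 0) (by simp [hg.2 2, hA2])
      Even.zero cuspSpanEvenAtTwo_level51
  have hN : 51 * (139 * 7 ^ 2) = ((⟨0, -1, 1, -32210705, -70352938111⟩ : WeierstrassCurve ℤ).baseChange ℚ).conductorNorm ℤ := by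
    norm_num [hNW]
  have hNA' : ((⟨0, 1, 1, 1, -1⟩ : WeierstrassCurve ℤ).baseChange ℚ).conductorNorm ℤ ∣ ((⟨0, -1, 1, -32210705, -70352938111⟩ : WeierstrassCurve ℤ).baseChange ℚ).conductorNorm ℤ := by
    rw [hNA, hNW]; norm_num
  -- two odd integers agree mod 2
  have hodd : ∀ a b : ℤ, Odd a → Odd b → ((a : ℤ) : ZMod 2) = ((b : ℤ) : ZMod 2) := by
    rintro a b ⟨c, rfl⟩ ⟨d, rfl⟩
    push_cast
    have h2 : (2 : ZMod 2) = 0 := by decide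
    rw [h2, zero_mul, zero_mul]
  refine flatAtTwo_turnkey_prime_sq_level hBuz hSe hSD hMK hE.2.2 hE.2.1 hΔ hf _ hAf _ hNA' e he
    (N₀ := 51) (q := 139) (ℓ := 7) (by norm_num) (by norm_num) (by norm_num) (by decide) (by decide) hN g hg _ hBg
    (by rw [hA2]; exact Even.zero) hA139 hA7 hW139 hW7 (fun p hp hp51 ↦ ?_) hres
  -- `p ∣ 51 ⇒ p ∈ {3, 17}`, where both curves are multiplicative (`a_p` odd)
  rcases (Nat.Prime.dvd_mul hp : p ∣ 3 * 17 ↔ _).mp hp51 with h | h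
  · obtain rfl := (Nat.prime_dvd_prime_iff_eq hp (by norm_num)).mp h
    exact hodd _ _ hW3 hA3
  · obtain rfl := (Nat.prime_dvd_prime_iff_eq hp (by norm_num)).mp h
    exact hodd _ _ hW17 hA17

end MultOneDictionary

end Summit.BirchSwinnertonDyer.BirchSwinnertonDyer.Theorems.SignedMuAtTwo

end
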